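import Summits.MatrixMultiplication.MatrixMultiplication.Theorems.ObstructionDescentUniversalOccurrence
import Literature.Computability.AlgebraicComplexity.Lickteig1985TypicalRank444Proofs

set_option linter.dupNamespace false
set_option autoImplicit false

/-!
# Obstruction descent — universal occurrence at format `4` is unconditional from `m = 7` on (Lickteig discharged)
# (decomp-mm · lens 3 · gen 32, third kernel, def-free)

`route-MatrixMultiplication-ObstructionDescent`, crux `NoOccurrenceObstruction` (`P_O`, stmt 29040); NODE-g32 §1.  The companion kernel
`ObstructionDescentUniversalOccurrence.lean` proved `UOCC(m,4)` for all `m ≥ 7` under the LITERAL hypothesis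
`∀ t : Fin 4 → Fin 4 → Fin 4 → ℂ, algBorderRank t ≤ 7` (Lickteig's typical rank of `4×4×4`), because the module of the tree's PROOF of that
fact (`Lickteig1985_typicalRank444_holds`: Terracini + Jacobian criterion + Alder) awaited a farm build.  This file discharges it:
**unconditionally, every partition triple occurring for ANY tensor of format `≤ 4` occurs for the unit tensor `⟨m⟩`, for every `m ≥ 7`**
(`uocc_four_of_seven_le'`), so the universal-occurrence threshold of format `4` satisfies **`u(4) ∈ {6, 7}`** unconditionally
(`six_le_of_uocc_four`, `not_uocc_four_of_le_five` in the companion; the tripod kernel's unconditional `u(4) ≤ 8`, `uocc_eight_four`, is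
superseded by one); `u(4) = 6 ⟺ UOCC(6,4)` remains OPEN (it implies the open `P_O`-cell `(2,6)`, `semigroup_le_two_six_of_uocc`;
the cells `(2,m)`, `m ≥ 7`, are known MM-specifically from `R(⟨2,2,2⟩) ≤ 7`, `semigroup_le_two_of_seven_le`).
No proposition is defined; no `def`; sorry-free; standard axioms.  Nothing here proves `ω = 2`.
[cite: Lickteig1985, p. 95] [cite: BurgisserClausenShokrollahi1997, Ex. 20.9, Thm. (20.3)] [cite: BurgisserIkenmeyer2011, §3.1, Lemma 6.1]
-/

noncomputable section

namespace Summit.MatrixMultiplication.MatrixMultiplication.Theorems.ObstructionCalculus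

open Literature.Computability.AlgebraicComplexity (kroneckerPow isotypicSum₁ isotypicSum₂ isotypicSum₃ unitTensor
  Lickteig1985_typicalRank444_holds)

/-- **`UOCC(m,4)` for every `m ≥ 7`, unconditionally**: every triple occurring in a tensor power of any complex tensor on an index type of
cardinality `≤ 4` occurs in the same tensor power of `⟨m⟩` (Lickteig: every `4×4×4` tensor has border rank `≤ 7`; Alder; the occurrence
calculus). [cite: Lickteig1985, p. 95] [cite: BurgisserClausenShokrollahi1997, Ex. 20.9, Thm. (20.3)] -/
theorem uocc_four_of_seven_le' {m : ℕ} (hm : 7 ≤ m) :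
    ∀ {ι : Type} [Fintype ι], Fintype.card ι ≤ 4 → ∀ (s : ι → ι → ι → ℂ) (d : ℕ)
      (lam : Fin 3 → Nat.Partition d),
      isotypicSum₁ (lam 0) (isotypicSum₂ (lam 1) (isotypicSum₃ (lam 2) (kroneckerPow s d))) ≠ 0 →
      isotypicSum₁ (lam 0) (isotypicSum₂ (lam 1) (isotypicSum₃ (lam 2) (kroneckerPow (unitTensor ℂ m) d))) ≠ 0 :=
  uocc_four_of_seven_le (fun t => Lickteig1985_typicalRank444_holds ℂ t) hm

/-- **The format-`4` row of the universal-occurrence instrument, unconditionally**: `UOCC(m,4)` fails for `m ≤ 5` and holds for `m ≥ 7`;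
hence `u(4) ∈ {6,7}` and the one open value is `UOCC(6,4)`. [cite: BurgisserIkenmeyer2011, Lemma 6.1] [cite: Lickteig1985, p. 95] -/
theorem uocc_four_row {m : ℕ} :
    (m ≤ 5 → ¬ (∀ {ι : Type} [Fintype ι], Fintype.card ι ≤ 4 → ∀ (s : ι → ι → ι → ℂ) (d : ℕ)
      (lam : Fin 3 → Nat.Partition d),
      isotypicSum₁ (lam 0) (isotypicSum₂ (lam 1) (isotypicSum₃ (lam 2) (kroneckerPow s d))) ≠ 0 →
      isotypicSum₁ (lam 0) (isotypicSum₂ (lam 1) (isotypicSum₃ (lam 2) (kroneckerPow (unitTensor ℂ m) d))) ≠ 0)) ∧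
    (7 ≤ m → ∀ {ι : Type} [Fintype ι], Fintype.card ι ≤ 4 → ∀ (s : ι → ι → ι → ℂ) (d : ℕ)
      (lam : Fin 3 → Nat.Partition d),
      isotypicSum₁ (lam 0) (isotypicSum₂ (lam 1) (isotypicSum₃ (lam 2) (kroneckerPow s d))) ≠ 0 →
      isotypicSum₁ (lam 0) (isotypicSum₂ (lam 1) (isotypicSum₃ (lam 2) (kroneckerPow (unitTensor ℂ m) d))) ≠ 0) :=
  ⟨fun hm => not_uocc_four_of_le_five hm, fun hm => uocc_four_of_seven_le' hm⟩


end Summit.MatrixMultiplication.MatrixMultiplication.Theorems.ObstructionCalculus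

end
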